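import Summits.QuantumFields.BalabanUV.T4Continuum.Support.NE7EtaPlainGradientLetters
import Summits.QuantumFields.BalabanUV.T4Continuum.Support.SkeletonPrecompTools
import HarnessLib

/-!
# NE7PlaquetteQuotientGradient — socket `h′` SUPPLIER LINE, stub (S-b) first half (ROAD-G106 §4): THE PLAQUETTE QUOTIENT OF THE PAIR IS LIPSCHITZ WITH
# THE POINTWISE-REGULARITY DATA — for `U′ = W·e^{X}` (unitary `W`, skew `X`, `‖X‖ ≤ α`), the transported adjacent difference of
# `D(p) := U′(∂p)·W(∂p)⁻¹ − 1` is at most `x₁(U′) + x₁(W) + 2(e^α − 1)·x(U′)`, where `x₁(·)` are the plaquette-GRADIENT radii ([Balaban1985Variational] Thm 1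
# (10) TYPE, the `grad` field of `MinimalActionRefine.RegularSup` through `NE3FluxGradientDictionary`) and `x(U′)` the plaquette radius of `U′`

Cell `pub-balaban`, rung (B)+1 sub-cell t4, lineage `b2b-balaban-t4-ne7-p1`, generation 106 (CRUX PROVER NE7 #1 = OWNER of BINDER row NE7).
Memo `t4/b2b-balaban-t4-ne7-p1-g106/ROAD-G106.md` §4 (S-b).
WHY.  The C¹ slice letter (S-d) that is to deliver (Lip₁ᶜ) + (Höl½ᶜ) for the relative coordinate `X` of the minimiser pair takes as data the dressed curl
`d_W X` AND ITS COVARIANT GRADIENT (one lattice derivative on the data: the curl must be Lipschitz at scale `M`, memo §4).  By the reverse curl reading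
(`NE3CurlReverseReading.norm_curlAt_le_of_vary`) the curl is the plaquette quotient `D` up to a second-order remainder; THIS FILE bounds the transported
adjacent differences of `D` by the plaquette-gradient radii of the two configurations — exactly the `RegularSup`-type data (for `W = cavg U_B`:
`NE3AveragedGradientRadius.norm_plaqGrad_cavg_le_of_regularSup`; for `U′ = U_A^{u}`: `RegularSup U_A`, gauge invariant).  The second half of (S-b) — the
same for the second-order remainder, through gens 70–75's `dcurlAt` letters — is the next gen's.
WHAT ([folklore]; 0 def, 0 sorry; any dimension, any `U(n)`).  §1 algebra of `Ad` (`Ad_mul_right`, `Ad_inv_sub_inv_eq`; `Ad_apply_one` is `SkeletonPrecompTools`'); §2 **`norm_plaqQuot_covDiff_le`**: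
`‖Ad (W p λ) (U′(∂p′)·W(∂p′)⁻¹ − 1) − (U′(∂p)·W(∂p)⁻¹ − 1)‖ ≤ x₁U + x₁W + 2(e^α − 1)·xU` (`p′ = p + e_λ`, plaquettes `(μ, ν)` at `p`, `p′`; `xU ≥ ‖U′(∂p′) − 1‖`,
`x₁U ≥` the `U′`-transported adjacent difference of `U′`'s plaquettes, `x₁W ≥` the `W`-transported one of `W`'s); §3 `norm_plaqQuot_covDiff_le_scaled` — the
`RegularSup` currency: `x₁U = 2c_A·ξ³`, `x₁W = 2c_W·ξ³`, `xU ≤ b·ξ²`, `α ≤ C_S·ε·ξ`, `ξ = (L^k)⁻¹ ≤ 1`, `C_Sε ≤ 1` ⟹ `≤ (2c_A + 2c_W + 6C_Sε·b)·ξ³`.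
HONEST FRAMING (page 1): lattice kinematics on OUR objects; the radii are HYPOTHESES (printed TYPE [B11] Thm 1 (10), asserted for no minimiser); nothing of Bałaban's
asserted as an axiom; nothing of NE3∕NE7 discharged; spine count = dagwriter∕referees' call; FIXED FINITE T⁴, rung (B)+1 — NOT infinite volume, NOT mass gap, NOT
BetaPertH, NOT Clay.
-/

set_option autoImplicit false

open scoped BigOperators Matrix Matrix.Norms.L2Operator
open Finset NormedSpace

namespace Summit.QuantumFields.BalabanUV.T4Continuum.NE7PlaquetteQuotientGradient

open Literature.MathematicalPhysics.QuantumFieldTheory.Balaban1983to89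
open B7Prop1Explicit B7Prop2Explicit
open T4AveragingDeficitWall hiding Site Plane Plaq Bond
open T4AveragingDeficitNonAbelian (Ad_mul Ad_sub U1_of_unitaryUnits)
open AveragingDeficitTransport (norm_Ad_of_unitary)
open AveragingDeficitNearIdentity (norm_Ad_sub_le)
open AveragingDeficitPlaqDeriv (vary_isUnitaryCfg)
open NE7EtaPlainGradientLetters (val_vary_one)
open SkeletonPrecompTools (Ad_apply_one)

noncomputable section

variable {d : ℕ} {n : Type*} [Fintype n] [DecidableEq n]

/-! ## §1 Algebra of `Ad` -/

/-- `Ad_u (X·Y) = Ad_u X · Ad_u Y`. [folklore] -/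
theorem Ad_mul_right (u : (Matrix n n ℂ)ˣ) (X Y : Matrix n n ℂ) : Ad u (X * Y) = Ad u X * Ad u Y := by
  unfold Ad
  simp only [mul_assoc, Units.inv_mul_cancel_left]

/-- For units `P′, P` and a unit `u`: `Ad_u (P′⁻¹) − P⁻¹ = Ad_u (P′⁻¹) · (P − Ad_u P′) · P⁻¹`. [folklore] -/
theorem Ad_inv_sub_inv_eq (u P' P : (Matrix n n ℂ)ˣ) :
    Ad u ((P'⁻¹ : (Matrix n n ℂ)ˣ) : Matrix n n ℂ) - ((P⁻¹ : (Matrix n n ℂ)ˣ) : Matrix n n ℂ)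
      = Ad u ((P'⁻¹ : (Matrix n n ℂ)ˣ) : Matrix n n ℂ) * ((P : Matrix n n ℂ) - Ad u (P' : Matrix n n ℂ)) * ((P⁻¹ : (Matrix n n ℂ)ˣ) : Matrix n n ℂ) := by
  have h1 : Ad u ((P'⁻¹ : (Matrix n n ℂ)ˣ) : Matrix n n ℂ) * Ad u (P' : Matrix n n ℂ) = 1 := by
    rw [← Ad_mul_right, Units.inv_mul, Ad_apply_one]
  rw [mul_sub, sub_mul, mul_assoc (Ad u _) (P : Matrix n n ℂ), Units.mul_inv, mul_one, h1, one_mul]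

/-! ## §2 The transported adjacent difference of the plaquette quotient -/

/-- **THE PLAQUETTE QUOTIENT OF THE PAIR IS LIPSCHITZ WITH THE POINTWISE-REGULARITY DATA.**  `W` unitary, `X` skew with `‖X(b)‖ ≤ α`, `U′ := vary W X 1`
(`= W·e^{X}` bondwise); a bond `(p, λ)`, a plaquette word `(μ, ν)`, `p′ = p + e_λ`; the radii `xU ≥ ‖U′(∂p′) − 1‖`, `x₁U ≥ ‖Ad_{U′(p,λ)} U′(∂p′) − U′(∂p)‖`,
`x₁W ≥ ‖Ad_{W(p,λ)} W(∂p′) − W(∂p)‖`.  THEN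
`‖Ad_{W(p,λ)} (U′(∂p′)·W(∂p′)⁻¹ − 1) − (U′(∂p)·W(∂p)⁻¹ − 1)‖ ≤ x₁U + x₁W + 2(e^α − 1)·xU`. [folklore] -/
theorem norm_plaqQuot_covDiff_le [Nonempty n] {W : Site d → Fin d → (Matrix n n ℂ)ˣ} (hW : IsUnitaryCfg W)
    {X : Site d → Fin d → Matrix n n ℂ} (hX : IsSkewDir X) {α : ℝ} (hXα : ∀ x κ, ‖X x κ‖ ≤ α)
    (p : Site d) (lam μ ν : Fin d) {xU x₁U x₁W : ℝ}
    (hxU : ‖((hol (vary W X 1) (p + e lam) (plaqWord μ ν) : (Matrix n n ℂ)ˣ) : Matrix n n ℂ) - 1‖ ≤ xU)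
    (hx₁U : ‖Ad (vary W X 1 p lam) ((hol (vary W X 1) (p + e lam) (plaqWord μ ν) : (Matrix n n ℂ)ˣ) : Matrix n n ℂ)
        - ((hol (vary W X 1) p (plaqWord μ ν) : (Matrix n n ℂ)ˣ) : Matrix n n ℂ)‖ ≤ x₁U)
    (hx₁W : ‖Ad (W p lam) ((hol W (p + e lam) (plaqWord μ ν) : (Matrix n n ℂ)ˣ) : Matrix n n ℂ)
        - ((hol W p (plaqWord μ ν) : (Matrix n n ℂ)ˣ) : Matrix n n ℂ)‖ ≤ x₁W) :
    ‖Ad (W p lam) (((hol (vary W X 1) (p + e lam) (plaqWord μ ν) * (hol W (p + e lam) (plaqWord μ ν))⁻¹ : (Matrix n n ℂ)ˣ) : Matrix n n ℂ) - 1)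
        - ((((hol (vary W X 1) p (plaqWord μ ν) * (hol W p (plaqWord μ ν))⁻¹ : (Matrix n n ℂ)ˣ) : Matrix n n ℂ)) - 1)‖
      ≤ x₁U + x₁W + 2 * (Real.exp α - 1) * xU := by
  -- names
  set U' := vary W X 1 with hU'
  have hU'u : IsUnitaryCfg U' := vary_isUnitaryCfg hW hX 1
  set A' : (Matrix n n ℂ)ˣ := hol U' (p + e lam) (plaqWord μ ν) with hA'
  set A : (Matrix n n ℂ)ˣ := hol U' p (plaqWord μ ν) with hA
  set B' : (Matrix n n ℂ)ˣ := hol W (p + e lam) (plaqWord μ ν) with hB'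
  set B : (Matrix n n ℂ)ˣ := hol W p (plaqWord μ ν) with hB
  set w : (Matrix n n ℂ)ˣ := W p lam with hw
  -- unit-ball facts
  have hU1W : ∀ x κ, W x κ ∈ U1 (Matrix n n ℂ) := fun x κ => U1_of_unitaryUnits (hW x κ)
  have hU1U : ∀ x κ, U' x κ ∈ U1 (Matrix n n ℂ) := fun x κ => U1_of_unitaryUnits (hU'u x κ)
  have hA1 : ‖(A : Matrix n n ℂ)‖ ≤ 1 := (mem_U1.mp (hol_mem hU1U p (plaqWord μ ν))).1
  have hBi1 : ‖((B⁻¹ : (Matrix n n ℂ)ˣ) : Matrix n n ℂ)‖ ≤ 1 := (mem_U1.mp (hol_mem hU1W p (plaqWord μ ν))).2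
  have hB'i1 : ‖((B'⁻¹ : (Matrix n n ℂ)ˣ) : Matrix n n ℂ)‖ ≤ 1 := (mem_U1.mp (hol_mem hU1W (p + e lam) (plaqWord μ ν))).2
  have hwu : w ∈ unitaryUnits (Matrix n n ℂ) := hW p lam
  -- the algebraic split: `Ad_w(A′B′⁻¹ − 1) − (AB⁻¹ − 1) = (Ad_w A′ − A)·Ad_w B′⁻¹ + A·(Ad_w B′⁻¹ − B⁻¹)`
  have hsplit : Ad w (((A' * B'⁻¹ : (Matrix n n ℂ)ˣ) : Matrix n n ℂ) - 1) - ((((A * B⁻¹ : (Matrix n n ℂ)ˣ) : Matrix n n ℂ)) - 1)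
      = (Ad w (A' : Matrix n n ℂ) - (A : Matrix n n ℂ)) * Ad w ((B'⁻¹ : (Matrix n n ℂ)ˣ) : Matrix n n ℂ)
        + (A : Matrix n n ℂ) * (Ad w ((B'⁻¹ : (Matrix n n ℂ)ˣ) : Matrix n n ℂ) - ((B⁻¹ : (Matrix n n ℂ)ˣ) : Matrix n n ℂ)) := by
    rw [Ad_sub, Ad_apply_one, Units.val_mul, Units.val_mul, Ad_mul_right]
    try noncomm_ring
  -- term 2: `‖Ad_w B′⁻¹ − B⁻¹‖ ≤ x₁W`
  have hT2 : ‖Ad w ((B'⁻¹ : (Matrix n n ℂ)ˣ) : Matrix n n ℂ) - ((B⁻¹ : (Matrix n n ℂ)ˣ) : Matrix n n ℂ)‖ ≤ x₁W := by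
    rw [Ad_inv_sub_inv_eq]
    have h1 : ‖Ad w ((B'⁻¹ : (Matrix n n ℂ)ˣ) : Matrix n n ℂ)‖ ≤ 1 := by rw [norm_Ad_of_unitary hwu]; exact hB'i1
    have h2 : ‖(B : Matrix n n ℂ) - Ad w (B' : Matrix n n ℂ)‖ ≤ x₁W := by rw [norm_sub_rev]; exact hx₁W
    have hx₁W0 : 0 ≤ x₁W := (norm_nonneg _).trans hx₁W
    calc _ ≤ ‖Ad w ((B'⁻¹ : (Matrix n n ℂ)ˣ) : Matrix n n ℂ) * ((B : Matrix n n ℂ) - Ad w (B' : Matrix n n ℂ))‖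
            * ‖((B⁻¹ : (Matrix n n ℂ)ˣ) : Matrix n n ℂ)‖ := norm_mul_le _ _
      _ ≤ (‖Ad w ((B'⁻¹ : (Matrix n n ℂ)ˣ) : Matrix n n ℂ)‖ * ‖(B : Matrix n n ℂ) - Ad w (B' : Matrix n n ℂ)‖) * 1 :=
            mul_le_mul (norm_mul_le _ _) hBi1 (norm_nonneg _) (by positivity)
      _ ≤ (1 * x₁W) * 1 := mul_le_mul_of_nonneg_right (mul_le_mul h1 h2 (norm_nonneg _) zero_le_one) zero_le_one
      _ = x₁W := by ring
  -- term 1: `‖Ad_w A′ − A‖ ≤ x₁U + 2(e^α − 1)·xU`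
  have hT1 : ‖Ad w (A' : Matrix n n ℂ) - (A : Matrix n n ℂ)‖ ≤ x₁U + 2 * (Real.exp α - 1) * xU := by
    -- the bond factor `eU = w⁻¹·U′(p,λ) = e^{X(p,λ)}`
    set eU : (Matrix n n ℂ)ˣ := w⁻¹ * U' p lam with heU
    have heUu : eU ∈ unitaryUnits (Matrix n n ℂ) := (unitaryUnits _).mul_mem ((unitaryUnits _).inv_mem hwu) (hU'u p lam)
    have hUfac : U' p lam = w * eU := by rw [heU, mul_inv_cancel_left]
    have heUval : (eU : Matrix n n ℂ) = exp (X p lam) := by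
      rw [heU, Units.val_mul, hU', val_vary_one, ← hw, ← mul_assoc, Units.inv_mul, one_mul]
    have heU1 : ‖(eU : Matrix n n ℂ) - 1‖ ≤ Real.exp α - 1 := by
      rw [heUval]; exact (norm_exp_sub_one_le_of_norm_le (hXα p lam)).1
    -- `Ad_w A′ − Ad_{U′} A′ = Ad_w (A′ − Ad_{eU} A′)`
    have hdiff : Ad w (A' : Matrix n n ℂ) - Ad (U' p lam) (A' : Matrix n n ℂ) = Ad w ((A' : Matrix n n ℂ) - Ad eU (A' : Matrix n n ℂ)) := by
      rw [hUfac, Ad_mul, Ad_sub]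
    have hcomm : ‖(A' : Matrix n n ℂ) - Ad eU (A' : Matrix n n ℂ)‖ ≤ 2 * (Real.exp α - 1) * xU := by
      have e1 : (A' : Matrix n n ℂ) - Ad eU (A' : Matrix n n ℂ) = -(Ad eU ((A' : Matrix n n ℂ) - 1) - ((A' : Matrix n n ℂ) - 1)) := by
        rw [Ad_sub, Ad_apply_one]; abel
      rw [e1, norm_neg]
      calc ‖Ad eU ((A' : Matrix n n ℂ) - 1) - ((A' : Matrix n n ℂ) - 1)‖ ≤ 2 * ‖(eU : Matrix n n ℂ) - 1‖ * ‖(A' : Matrix n n ℂ) - 1‖ :=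
            norm_Ad_sub_le heUu _
        _ ≤ 2 * (Real.exp α - 1) * xU := by
            have h0 : 0 ≤ Real.exp α - 1 := (norm_nonneg _).trans heU1
            exact mul_le_mul (mul_le_mul_of_nonneg_left heU1 (by norm_num)) hxU (norm_nonneg _) (by positivity)
    calc ‖Ad w (A' : Matrix n n ℂ) - (A : Matrix n n ℂ)‖
        = ‖(Ad (U' p lam) (A' : Matrix n n ℂ) - (A : Matrix n n ℂ)) + (Ad w (A' : Matrix n n ℂ) - Ad (U' p lam) (A' : Matrix n n ℂ))‖ := by
          congr 1; abel
      _ ≤ ‖Ad (U' p lam) (A' : Matrix n n ℂ) - (A : Matrix n n ℂ)‖ + ‖Ad w (A' : Matrix n n ℂ) - Ad (U' p lam) (A' : Matrix n n ℂ)‖ := norm_add_le _ _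
      _ ≤ x₁U + 2 * (Real.exp α - 1) * xU := by
          rw [hdiff, norm_Ad_of_unitary hwu]
          exact add_le_add hx₁U hcomm
  -- assemble
  have hT1n : 0 ≤ x₁U + 2 * (Real.exp α - 1) * xU := (norm_nonneg _).trans hT1
  rw [hsplit]
  calc _ ≤ ‖(Ad w (A' : Matrix n n ℂ) - (A : Matrix n n ℂ)) * Ad w ((B'⁻¹ : (Matrix n n ℂ)ˣ) : Matrix n n ℂ)‖
          + ‖(A : Matrix n n ℂ) * (Ad w ((B'⁻¹ : (Matrix n n ℂ)ˣ) : Matrix n n ℂ) - ((B⁻¹ : (Matrix n n ℂ)ˣ) : Matrix n n ℂ))‖ := norm_add_le _ _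
    _ ≤ (x₁U + 2 * (Real.exp α - 1) * xU) * 1 + 1 * x₁W := by
        refine add_le_add ?_ ?_
        · refine (norm_mul_le _ _).trans (mul_le_mul hT1 ?_ (norm_nonneg _) hT1n)
          rw [norm_Ad_of_unitary hwu]; exact hB'i1
        · exact (norm_mul_le _ _).trans (mul_le_mul hA1 hT2 (norm_nonneg _) zero_le_one)
    _ = x₁U + x₁W + 2 * (Real.exp α - 1) * xU := by ring

/-! ## §3 The `RegularSup` currency -/

/-- **THE SAME AT THE TREE'S SCALES**: with `ξ ≤ 1`, `x₁U ≤ 2c_A·ξ³`, `x₁W ≤ 2c_W·ξ³`, `xU ≤ b·ξ²` (`b ≥ 0`), `α ≤ C_Sε·ξ` with `C_Sε ≤ 1`: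
the transported adjacent difference of the plaquette quotient is `≤ (2c_A + 2c_W + 6·C_Sε·b)·ξ³` (`e^α − 1 ≤ 3α` for `α ≤ 1`). [folklore] -/
theorem norm_plaqQuot_covDiff_le_scaled [Nonempty n] {W : Site d → Fin d → (Matrix n n ℂ)ˣ} (hW : IsUnitaryCfg W)
    {X : Site d → Fin d → Matrix n n ℂ} (hX : IsSkewDir X) {α ξ cA cW b CSε : ℝ} (hXα : ∀ x κ, ‖X x κ‖ ≤ α)
    (hξ0 : 0 ≤ ξ) (hξ1 : ξ ≤ 1) (hb : 0 ≤ b) (hCS1 : CSε ≤ 1) (hαle : α ≤ CSε * ξ)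
    (p : Site d) (lam μ ν : Fin d)
    (hxU : ‖((hol (vary W X 1) (p + e lam) (plaqWord μ ν) : (Matrix n n ℂ)ˣ) : Matrix n n ℂ) - 1‖ ≤ b * ξ ^ 2)
    (hx₁U : ‖Ad (vary W X 1 p lam) ((hol (vary W X 1) (p + e lam) (plaqWord μ ν) : (Matrix n n ℂ)ˣ) : Matrix n n ℂ)
        - ((hol (vary W X 1) p (plaqWord μ ν) : (Matrix n n ℂ)ˣ) : Matrix n n ℂ)‖ ≤ 2 * cA * ξ ^ 3)
    (hx₁W : ‖Ad (W p lam) ((hol W (p + e lam) (plaqWord μ ν) : (Matrix n n ℂ)ˣ) : Matrix n n ℂ)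
        - ((hol W p (plaqWord μ ν) : (Matrix n n ℂ)ˣ) : Matrix n n ℂ)‖ ≤ 2 * cW * ξ ^ 3) :
    ‖Ad (W p lam) (((hol (vary W X 1) (p + e lam) (plaqWord μ ν) * (hol W (p + e lam) (plaqWord μ ν))⁻¹ : (Matrix n n ℂ)ˣ) : Matrix n n ℂ) - 1)
        - ((((hol (vary W X 1) p (plaqWord μ ν) * (hol W p (plaqWord μ ν))⁻¹ : (Matrix n n ℂ)ˣ) : Matrix n n ℂ)) - 1)‖
      ≤ (2 * cA + 2 * cW + 6 * CSε * b) * ξ ^ 3 := by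
  have h := norm_plaqQuot_covDiff_le hW hX hXα p lam μ ν hxU hx₁U hx₁W
  have hα0 : 0 ≤ α := (norm_nonneg _).trans (hXα p lam)
  have hα1 : α ≤ 1 := hαle.trans (by nlinarith)
  -- `e^α − 1 ≤ 3α` on `[0, 1]` (`e^α − 1 ≤ α e^α ≤ 3α`)
  have hexp : Real.exp α - 1 ≤ 3 * α := by
    have h1 := Real.add_one_le_exp (-α)
    have h2 : Real.exp α * Real.exp (-α) = 1 := by rw [← Real.exp_add, add_neg_cancel, Real.exp_zero]
    have h3 : Real.exp α ≤ Real.exp 1 := Real.exp_le_exp.mpr hα1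
    have h4 : Real.exp 1 ≤ 3 := by
      have := Real.exp_one_lt_d9; linarith
    have h5 : Real.exp α * (-α + 1) ≤ Real.exp α * Real.exp (-α) := mul_le_mul_of_nonneg_left h1 (Real.exp_pos α).le
    have h6 : α * Real.exp α ≤ α * 3 := mul_le_mul_of_nonneg_left (h3.trans h4) hα0
    nlinarith [h5, h6, h2]
  have hstep : 2 * (Real.exp α - 1) * (b * ξ ^ 2) ≤ 6 * CSε * b * ξ ^ 3 := by
    have h1 : 2 * (Real.exp α - 1) ≤ 6 * (CSε * ξ) := by linarith
    have h0 : 0 ≤ b * ξ ^ 2 := by positivity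
    calc 2 * (Real.exp α - 1) * (b * ξ ^ 2) ≤ 6 * (CSε * ξ) * (b * ξ ^ 2) := mul_le_mul_of_nonneg_right h1 h0
      _ = 6 * CSε * b * ξ ^ 3 := by ring
  have hexp0 : 0 ≤ Real.exp α - 1 := by linarith [Real.add_one_le_exp α]
  have hxU' : 2 * (Real.exp α - 1) * ‖((hol (vary W X 1) (p + e lam) (plaqWord μ ν) : (Matrix n n ℂ)ˣ) : Matrix n n ℂ) - 1‖
      ≤ 2 * (Real.exp α - 1) * (b * ξ ^ 2) := mul_le_mul_of_nonneg_left hxU (by positivity)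
  have h' := norm_plaqQuot_covDiff_le hW hX hXα p lam μ ν le_rfl hx₁U hx₁W
  calc _ ≤ 2 * cA * ξ ^ 3 + 2 * cW * ξ ^ 3
          + 2 * (Real.exp α - 1) * ‖((hol (vary W X 1) (p + e lam) (plaqWord μ ν) : (Matrix n n ℂ)ˣ) : Matrix n n ℂ) - 1‖ := h'
    _ ≤ 2 * cA * ξ ^ 3 + 2 * cW * ξ ^ 3 + 6 * CSε * b * ξ ^ 3 := by linarith
    _ = (2 * cA + 2 * cW + 6 * CSε * b) * ξ ^ 3 := by ring

end

end Summit.QuantumFields.BalabanUV.T4Continuum.NE7PlaquetteQuotientGradient
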